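import Summits.BirchSwinnertonDyer.Rank1Residual.O5.O5UncleanParity
import HarnessLib

/-!
# O5 — GEN 11: the 3-adic COST LAW (T28) — grade β of the transfer certificate T27 made LAW-decidable,
# the two new Kummer-line clauses n2 (additive potentially multiplicative) / n3 (tame potentially ORDINARY),
# and the CERTIFIED (KUM3LOC) Selmer transfer at grade β, with the census P-K17

Add-on to `O5KummerLine` / `O5KummerLineTwisted` (T18–T22: the Kummer line at `3` of every TAME potentially
supersingular curve and of its good / multiplicative companions) and to GEN 10's `O5TransferCertificate`
(T27 `CrudeSelmerTransferThree`, grade α⁺; typing p303410).  Census cell O5 = (t′), o5-r1 GEN 11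
(planner-b2b-bsdres-o5-r1-g11-0, 2026-08-21).  Informal text of record: `HOME/b2b-bsdres-o5-r1/gen11/T28-THREE-ADIC-COST-LAW.md`.

HONEST FRAMING (cell `b2b-bsdres`, run/shared/lean/b2b/bsd-rank1-residual/): research route, lane CLASS-CLOSURE
(`CLASS-CLOSURE-PLAN.md` §3.5 O5), experiment types (1) statement discovery with held-out validation, (2) obstruction
anatomy, (3) transport.  Every node is a `def … : Prop` tagged `@[conjecture]` (THEOREM-CANDIDATE with a written proof, or a
census law); the links are PROVED bookkeeping.  Nothing is asserted, nothing booked, no mark of `RESIDUAL-MAP.md` moves, NO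
Literature fact is minted; census numbers are EVIDENCE (P-K17, pre-registered `gen11/P-K17-PREREG.md` sha16 151e18faa5bd4577,
frozen before any run; frozen scorer); no main conjecture, no `L`-value, no Selmer group and no class group enters any computation.

## The statement in one paragraph (T28)
For `E/ℚ₃` with `h⁰(ℚ₃, E[3]) = 0` the local cohomology `H := H¹(ℚ₃, E[3])` is a HYPERBOLIC PLANE over `𝔽₃` (`h¹ = 2` by the
Euler characteristic, the Weil cup product is symmetric and non-degenerate, and the Kummer line `κ_E` is isotropic —
Poonen–Rains Prop. 4.11, tree `kummerClass_cupProduct_kummerClass_eq_zero_holds`), so it has exactly two isotropic lines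
(tree `isotropic_card_zero_or_four`, `isotropicLine_unique_off_line`) and `κ_E` is one of them: every such curve carries ONE BIT
`λ(E)`.  For a mod-3 congruent pair `(W, G)` with `h⁰₃ = 0` the 3-adic term of T27's budget is EXACTLY `[λ(W) ≠ λ(G)]`, so
grade β (`D_β = D_α⁺ − 1`) is valid iff the bits agree.  T18–T22 compute the bit on every TAME cell; n2 / n3 below add the
ramified quadratic twists of ordinary and multiplicative curves (`I₀*` potentially ordinary, `Iₙ*`): their bit is `L_C`
(Schaefer's isogeny-index formula with `a(φ) = 1` surviving the twist, T28 §2).  The only cells without a law are the 3-WILD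
potentially good companions (`v₃(N) ∈ {3,4,5}`), where P-K17 runs a hash-split discovery; on every cell the bit comparison is
CERTIFIED per pair by KUM3LOC (`KummerTorsorsAgreeAtThree`).

T28 (iv) — the BIT FORMULA (B), not typed here (it needs the quotient `E/C` as a curve over `ℚ₃`): for `E` with exactly
one `G_{ℚ₃}`-stable line `C ⊂ E[3]` and `h⁰(ℚ₃, E[3]) = 0`, TAME OR WILD,
`λ(E) = L_C ⟺ #H⁰(ℚ₃, E[3]/C) · 3^{a(φ̂)} · c₃(E)/c₃(E/C) = 1` (`φ : E → E/C` over `ℚ₃`, `a(φ̂) = v₃(φ̂^*ω^N_E/ω^N_{E/C})`),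
proved from T28 §2 Lemma 3 and Schaefer's index formula; supplementary census S17-2 (kit j140341/j140366): (B) agrees with the
torsor reading on 2 921/2 921 curves with one stable line (2 232 tame/semistable, 689 wild), 0 exceptions, and reproduces
T18/T18′/n2/n3/P-K3′/P-K5 cell by cell.  Wild findings (EVIDENCE, P-K17 §4 + S17-2): on wild curves with a stable line the
bit is decided by the 3-ISOGENOUS curve — `II*` class 11 → `L_C` (115), `II*`/`IV*` class 12 → other (133, `H⁰(E[3]/C) ≠ 0`),
`IV*` class 11 (`c₃ = 3`) → other (137, Tamagawa ratio 3), `II`/`IV` class 02 → `L_C` iff `c₃(E/C) = 3` (201 / 103) — so it is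
NOT a function of (Kodaira, f₃, c₃, v₃Δ, v₃j, v₃c₄, v₃c₆) of `E` alone on the `IV` cell (114 / 49); on wild curves with NO stable
line: `IV*` (`f₃ = 3`, `v₃Δ = 9`): `λ = ℓ₁*` iff `c₃ = 1`, `ℓ₁₁` iff `c₃ = 3` (hash-split law, 183 validation curves, 0 exceptions);
type `II` (`f₃ = 3`, `v₃Δ = 3`): not a function of those invariants (426 / 265) — open.

## Dictionary (O5KummerLine §0 (b), recalled)
For `ρ̄ := E[3]|G_{ℚ₃}` non-split with ONE stable line `C` of non-trivial character and `h⁰ = 0`, and an admissible base point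
`P`: `κ_E = L_C := im H¹(ℚ₃, C)` iff `Λ_P` has an irreducible CUBIC factor over `ℚ₃` (`HasIrredFactorOfDegree₃ _ 3`).

## TYPER PLACEMENT NOTE (cc-typer-5 GEN 10 = O5 §3.5 / O6 §3.4 typer of record; ask A-O5-26 of o5-r1 GEN 11,
## `HOME/INBOX.md` 2026-08-21T21:18:13Z; filed 2026-08-21T23:5xZ)

HONEST FRAMING as above (research route; every node an `@[conjecture] def … : Prop`, EVIDENCE-labelled; census numbers are
EVIDENCE, never a Literature fact; nothing asserted, nothing booked; no mark of `RESIDUAL-MAP.md` moves; NO Literature fact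
minted; O5 OPEN). PROVENANCE: the module text above this note and EVERY declaration below = o5-r1 GEN 11's
`HOME/b2b-bsdres-o5-r1/gen11/O5ThreeAdicCostLaw.lean` (sha16 `f01e56a8d43dd23e`, 256 l.; write-up
`gen11/T28-THREE-ADIC-COST-LAW.md` `7a4480b52a91f129`; pre-registration `gen11/P-K17-PREREG.md` `151e18faa5bd4577` frozen
20:44Z before any computation, kit j139907), BYTE-IDENTICAL — the typer's changes are this note only. Status precisions at
filing time: GEN 10's T27 file `O5/O5TransferCertificate.lean` HAS LANDED (p303410, bcb54d6bee95) — this file does not import it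
(o5-r1 kept the import closure at `O5UncleanParity`; `betaBudgetThree` is self-contained, = T27's `crudeBudgetThree` with the
3-adic term `1 + h⁰₃` removed up to the shared-split-node saving, as the docstring says); GEN 12's T29 file (A-O5-27,
`O5/O5RationalTorsionCostLaw.lean`) imports THIS file and REUSES `betaBudgetThree` under that name (o5-r1 GEN 12: "`awayBudgetThree`
= gen11 `betaBudgetThree`, merge" — merged by the typer, one declaration). DEDUP (tree grep on all 15 top-level names: no match;
reused, not re-declared: GEN 5's `kummerNinePolyThree` / `IsKummerBasePointThree` / `HasIrredFactorOfDegree₃` /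
`NoLocalThreeTorsionAt` / `KummerLineRamifiedQuotientThree` (`O5KummerLine.lean`), GEN 4's `numStableLinesAtThree`, GEN 7's
`IsCongruentModThree` / `KummerTorsorsAgreeAtThree` / `IsCleanPairAwayFromThree`, GEN 8's `transversePrimesThree` / `selmerDimThree` /
`FullLocalThreeTorsionAt`, `Additive.SubM` / `SubGordOrd`). AUDIT (advisory, expected shape of a typed-law file): 7 `conjecture`
nodes; `kummerTorsorsDifferTypeIIIPotTwistThree_of` is the proof-of-item of the class-02 DIFFER law CONDITIONAL on T18′ + n2 + n3
(all three stay `@[conjecture]`; nothing is discharged unconditionally); `HasKummerCertificateThree` is a predicate with a body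
(audit's `vendored-fact` mark on an untagged `def : Prop` used as a HYPOTHESIS shape, not a named fact); the PROVED §2/§4 links
are orphans by design. Bib keys `Schaefer1996`, `Katz1973`, `SilvermanATAEC1994`, `MazurRubin2015SelmerCompanions`,
`PoonenRains2012` present. CHECK: farm `lean check` rc 0 / 0 warnings / 0 sorries on these bytes.
-/

noncomputable section

open scoped Classical

open Polynomial WeierstrassCurve Literature.NumberTheory.EllipticCurves
  Literature.NumberTheory.EllipticCurves.Rank1Residual
  Summit.BirchSwinnertonDyer.Rank1Residual.Additive

namespace Summit.BirchSwinnertonDyer.Rank1Residual.O5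

/-! ## §1 n2 / n3 — the Kummer line of the RAMIFIED QUADRATIC TWISTS of ordinary and multiplicative curves -/

/-- **n2 `KummerLinePotMultThree` (THEOREM-CANDIDATE, o5-r1 GEN 11; proof T28 §2).**  Let `E/ℚ` be additive and
potentially multiplicative at `3` (Kodaira `Iₙ*`, `n ≥ 1`: `E = E₀ ⊗ ψ`, `E₀` a Tate curve, `ψ` ramified quadratic) with
`E(ℚ₃)[3] = 0` and one stable line `C` (then `C ≅ u`, `E[3]/C ≅ ωu`: census lineclass 02 — T28 Lemma 4).  Then
`κ_E = L_C`: `Λ_P` has an irreducible cubic factor for every admissible base point.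
PROOF: Schaefer's index formula for `φ̂ : E/C → E` gives `#coker φ̂(ℚ₃) = #(E[3]/C)(ℚ₃) · 3^{a(φ̂)} · c₃(E)/c₃(E/C)` with
`(E[3]/C)(ℚ₃) = 0`, `a(φ̂) = 0` (`a(φ) = 1`: the Tate parametrisation `u ↦ u³` pulls `du/u` back to `3·du/u`, and the
quadratic twist multiplies both Néron differentials by the same `d^{−1/2}`, the twisted models `y² = x³ + d a₂x² + …`
being minimal as `v₃(c₄) = 2`), so `#coker ∈ {1,3} ∩ (c₃(E)/c₃(E/C))·{1} ⊂ {1,3} ∩ {½,1,2}` forces `coker φ̂(ℚ₃) = 0`,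
i.e. `φ̂(E′(ℚ₃)) = E(ℚ₃)`, whence `κ_E ⊂ ι_* H¹(ℚ₃, C) = L_C` (`κ_E(φ̂P′) = ι_*δ_φ(P′)`), equality as both are lines.
Why it might fail: only through the dictionary (cubic factor ⟺ `κ ∈ L_C`) or the twist bookkeeping of `a(φ)`; ONE
admissible `Iₙ*` row with `h⁰₃ = 0`, one stable line and `Λ_P` irreducible refutes it.
[cite: Schaefer1996, Lemma 3.8 (arXiv:1507.08324 p. 9)] [cite: SilvermanATAEC1994, Thm. V.5.3 (Tate curve)]
[evidence: census cell O5, o5-r1 GEN 11, P-K17 kit j139907, pre-registered law cell n2: class-02 type-III W ~ Iₙ* companions KUM-DIFFERENT 400/400 kept pairs, companion Λ-pattern with a cubic factor 400/400; intrinsic: 337/337 additive Iₙ* singles with h⁰₃ = 0 read L_C, and the bit formula (B) of S17-2 (kit j140341/j140366) gives L_C on 337/337 with (h⁰(E[3]/C), a(φ̂), c₃(E)/c₃(E/C)) = (0, 0, 1) — counts in T28-THREE-ADIC-COST-LAW.md §4] -/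
@[conjecture] def KummerLinePotMultThree : Prop :=
  ∀ (E : WeierstrassCurve ℚ) [E.IsElliptic] [E.IsGloballyMinimal],
    Addv E 3 → SubM E 3 → numStableLinesAtThree E = 1 → NoLocalThreeTorsionAt E 3 →
      ∀ x y : ℚ_[3], IsKummerBasePointThree E x y → HasIrredFactorOfDegree₃ (kummerNinePolyThree E x) 3

/-- **n3 `KummerLinePotOrdThree` (THEOREM-CANDIDATE, o5-r1 GEN 11; proof T28 §2).**  Let `E/ℚ` be additive at `3` of
Delbourgo type (G) with potentially good ORDINARY reduction (`SubGordOrd`: Kodaira `I₀*`, `E = E₀ ⊗ ψ` with `E₀` good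
ordinary, `ψ` ramified quadratic), with `E(ℚ₃)[3] = 0` and one stable line `C` (`C ≅ u`, `E[3]/C ≅ ωu`, lineclass 02).
Then `κ_E = L_C`: `Λ_P` has an irreducible cubic factor for every admissible base point.
PROOF: as n2 with `C₀ ⊂ E₀[3]` the canonical subgroup: `a(φ₀) = 1` (`φ₀` is `t ↦ t³` on `Ê₀ ≅ Ĝ_m` over `W(𝔽̄₃)`),
`a(φ) = a(φ₀)` under the twist (minimal twisted model, `v₃(c₄(E₀)) = 0` for ordinary `E₀`), `(E[3]/C)(ℚ₃) = 0`,
`c₃(I₀*) ∈ {1,2,4}` on both sides, so `#coker φ̂(ℚ₃) ∈ {1,3} ∩ {¼,½,1,2,4} = {1}`.  (By-product: `c₃(E) = c₃(E/C)`.)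
Why it might fail: as n2; ONE admissible potentially-ordinary `I₀*` row with `h⁰₃ = 0`, one stable line and `Λ_P`
irreducible refutes it.
[cite: Schaefer1996, Lemma 3.8 (arXiv:1507.08324 p. 9)] [cite: Katz1973, Thm. 3.10.7 (canonical subgroup)]
[evidence: census cell O5, o5-r1 GEN 11, P-K17 kit j139907, pre-registered law cell n3: class-02 type-III W ~ tame potentially ordinary companions KUM-DIFFERENT 400/400 kept pairs, Λ-pattern with a cubic factor 400/400; intrinsic: 302/302 I₀* pot-ordinary singles with one stable line read L_C, bit formula (B) gives L_C on 302/302 with (h⁰(E[3]/C), a(φ̂), c₃(E)/c₃(E/C)) = (0, 0, 1) — T28-THREE-ADIC-COST-LAW.md §4] -/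
@[conjecture] def KummerLinePotOrdThree : Prop :=
  ∀ (E : WeierstrassCurve ℚ) [E.IsElliptic] [E.IsGloballyMinimal],
    Addv E 3 → SubGordOrd E 3 → numStableLinesAtThree E = 1 → NoLocalThreeTorsionAt E 3 →
      ∀ x y : ℚ_[3], IsKummerBasePointThree E x y → HasIrredFactorOfDegree₃ (kummerNinePolyThree E x) 3

/-! ## §2 The law for PAIRS on the reducible class 02 (PROVED from T18′ + n2 + n3) -/

/-- **T28 (ii), class 02: a type-III O5(t′) curve and a twisted ordinary / multiplicative companion carry the two
DIFFERENT isotropic lines** (`ℓ_tr` vs `L_C`): their Kummer torsors at `3` never agree, so the 3-adic term of the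
transfer budget is exactly `1` on these pairs (grade α⁺ is already sharp at `3`; no β gain).  Stated census-decidably;
PROVED below from T18′ `KummerLineRamifiedQuotientThree`, n2 and n3. [folklore] -/
@[conjecture] def KummerTorsorsDifferTypeIIIPotTwistThree : Prop :=
  ∀ (W X : WeierstrassCurve ℚ) [W.IsElliptic] [W.IsGloballyMinimal] [X.IsElliptic] [X.IsGloballyMinimal],
    ClassO5 W 3 → SubTprime W 3 → numStableLinesAtThree W = 1 → padicValRat 3 W.Δ = 3 → NoLocalThreeTorsionAt W 3 →
    Addv X 3 → (SubM X 3 ∨ SubGordOrd X 3) → numStableLinesAtThree X = 1 → NoLocalThreeTorsionAt X 3 →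
      ∀ x y x' y' : ℚ_[3], IsKummerBasePointThree W x y → IsKummerBasePointThree X x' y' →
        ¬ KummerTorsorsAgreeAtThree W X x x'

/-- The class-02 DIFFER law from T18′, n2, n3 (PROVED): `Λ^W` has no cubic factor, `Λ^X` has one, so the first clause
of `KummerTorsorsAgreeAtThree` fails. [folklore] -/
theorem kummerTorsorsDifferTypeIIIPotTwistThree_of
    (h18 : KummerLineRamifiedQuotientThree) (hn2 : KummerLinePotMultThree) (hn3 : KummerLinePotOrdThree) :
    KummerTorsorsDifferTypeIIIPotTwistThree := by
  intro W X _ _ _ _ h5 ht h1 hΔ h0 hadd hMG h1X h0X x y x' y' hP hP' hagree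
  have hW : ¬ HasIrredFactorOfDegree₃ (kummerNinePolyThree W x) 3 := h18 W h5 ht h1 hΔ h0 x y hP
  have hX : HasIrredFactorOfDegree₃ (kummerNinePolyThree X x') 3 := by
    rcases hMG with hM | hG
    · exact hn2 X hadd hM h1X h0X x' y' hP'
    · exact hn3 X hadd hG h1X h0X x' y' hP'
  exact hW (hagree.1.mpr hX)

/-- `Λ_x = Φ₃ − x·Ψ₃²` has degree `9` (`Φ₃` is monic of degree `9`, `deg Ψ₃² ≤ 8`). [folklore] -/
theorem natDegree_kummerNinePolyThree (W : WeierstrassCurve ℚ) (x : ℚ_[3]) :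
    (kummerNinePolyThree W x).natDegree = 9 := by
  have hΦ : ((W.baseChange ℚ_[3]).Φ 3).natDegree = 9 := by
    rw [WeierstrassCurve.natDegree_Φ]; norm_num
  have h4 := (W.baseChange ℚ_[3]).natDegree_Ψ₃_le
  have hΨ : (C x * (W.baseChange ℚ_[3]).Ψ₃ ^ 2).natDegree ≤ 8 :=
    (natDegree_C_mul_le _ _).trans (natDegree_pow_le.trans (by omega))
  unfold kummerNinePolyThree
  rw [natDegree_sub_eq_left_of_natDegree_lt (by omega), hΦ]

/-- An admissible nonic with an irreducible CUBIC factor is reducible (degree count). [folklore] -/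
theorem not_irreducible_of_hasIrredFactor_three (W : WeierstrassCurve ℚ) (x : ℚ_[3])
    (h : HasIrredFactorOfDegree₃ (kummerNinePolyThree W x) 3) : ¬ Irreducible (kummerNinePolyThree W x) := by
  intro hirr
  obtain ⟨q, hq, hdeg, r, hr⟩ := h
  rcases hirr.isUnit_or_isUnit hr with hu | hu
  · exact hq.not_isUnit hu
  · obtain ⟨c, hc, rfl⟩ := Polynomial.isUnit_iff.mp hu
    have h9 := natDegree_kummerNinePolyThree W x
    rw [hr, natDegree_mul_C hc.ne_zero, hdeg] at h9
    omega

/-- **Two twisted ordinary / multiplicative curves of class 02 have agreeing torsors** (both lines `= L_C`; the second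
clause of `KummerTorsorsAgreeAtThree` is vacuous as `Λ^W` is reducible).  PROVED from n2, n3. [folklore] -/
theorem kummerTorsorsAgree_potTwist_of (hn2 : KummerLinePotMultThree) (hn3 : KummerLinePotOrdThree)
    (W X : WeierstrassCurve ℚ) [W.IsElliptic] [W.IsGloballyMinimal] [X.IsElliptic] [X.IsGloballyMinimal]
    (hW : Addv W 3) (hMW : SubM W 3 ∨ SubGordOrd W 3) (h1W : numStableLinesAtThree W = 1)
    (h0W : NoLocalThreeTorsionAt W 3)
    (hX : Addv X 3) (hMX : SubM X 3 ∨ SubGordOrd X 3) (h1X : numStableLinesAtThree X = 1)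
    (h0X : NoLocalThreeTorsionAt X 3)
    (x y x' y' : ℚ_[3]) (hP : IsKummerBasePointThree W x y) (hP' : IsKummerBasePointThree X x' y') :
    KummerTorsorsAgreeAtThree W X x x' := by
  have cW : HasIrredFactorOfDegree₃ (kummerNinePolyThree W x) 3 := by
    rcases hMW with h | h
    · exact hn2 W hW h h1W h0W x y hP
    · exact hn3 W hW h h1W h0W x y hP
  have cX : HasIrredFactorOfDegree₃ (kummerNinePolyThree X x') 3 := by
    rcases hMX with h | h
    · exact hn2 X hX h h1X h0X x' y' hP'
    · exact hn3 X hX h h1X h0X x' y' hP'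
  exact ⟨⟨fun _ => cX, fun _ => cW⟩, fun hirr => (not_irreducible_of_hasIrredFactor_three W x cW hirr).elim⟩

/-! ## §3 The CERTIFIED Selmer transfer at grade β (T28 (i) / (iii)) -/

/-- **The grade-β budget** (self-contained UPPER bound for T27's `crudeBudgetThree − (1 + h⁰₃)`, i.e. the budget with the
3-adic term REMOVED): every transverse prime (`ℓ ≠ 3`, `3 ∣ c_ℓ`) of either curve costs `1`, a SHARED transverse prime with
full local 3-torsion costs one more.  (Cruder than `D_α⁺ − 1` only by the shared-split-node saving of T27.)  Census:
`#(T(W) ∪ T(G)) + #{ℓ ∈ T(W) ∩ T(G) : h⁰_ℓ = 2}`. [folklore] -/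
def betaBudgetThree (W G : WeierstrassCurve ℚ) [W.IsElliptic] [W.IsGloballyMinimal]
    [G.IsElliptic] [G.IsGloballyMinimal] : ℕ :=
  (transversePrimesThree W ∪ transversePrimesThree G).ncard +
    {ℓ ∈ transversePrimesThree W ∩ transversePrimesThree G | ∃ hℓ : ℓ.Prime, @FullLocalThreeTorsionAt W ℓ ⟨hℓ⟩}.ncard

/-- **A KUM3LOC certificate for the pair**: admissible base points on both sides whose Kummer torsors at `3` agree —
for `h⁰(ℚ₃, W[3]) = 0` and `W[3]|G_{ℚ₃}` irreducible or non-split, the decidable form of `κ_W = φ_*κ_G` (O5KummerLine §0,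
gen5 RESULT §0 stem-field lemma; the isomorphism `φ` is unique up to `±1`). [folklore] -/
def HasKummerCertificateThree (W G : WeierstrassCurve ℚ) : Prop :=
  ∃ x y x' y' : ℚ_[3], IsKummerBasePointThree W x y ∧ IsKummerBasePointThree G x' y' ∧ KummerTorsorsAgreeAtThree W G x x'

/-- **T28-β `CertifiedSelmerTransferThree` (THEOREM-CANDIDATE given T27's proof, o5-r1 GEN 11).**  For a mod-3 congruent pair
with `W[3]` irreducible, `h⁰(ℚ₃, W[3]) = 0`, at most one stable line at `3`, and a Kummer certificate (`κ_W = φ_*κ_G`): the two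
3-Selmer dimensions differ by at most the grade-β budget — the 3-adic term of T27 is `dim(κ_W + φ_*κ_G) − 1 = 0`.  `G` may be
of ANY type at `3` (good, multiplicative, tame or WILD additive).  Proof: T27 §1 (`finrank_selmerOf_le_add_sum`) with the local
codimension `0` at `v = 3`.  Why it might fail: only through T27 / the torsor dictionary.
[cite: MazurRubin2015SelmerCompanions, §2–§3 (arXiv:1203.0620)] [cite: PoonenRains2012, Prop. 4.11]
[evidence: census cell O5, o5-r1 GEN 11, P-K17 kit j139907 + supplementary S17-1: BSD-read two-sided Selmer intervals vs `D_β` on the 1 256 certified (kept KUM-EQUAL, h⁰₃ = 0) pairs — 0 violations, 716 pairs attain the bound; of the 5 141 kept pairs decided KUM-DIFFERENT, 1 922 have intervals exceeding `D_β` (the 3-adic unit is necessary there); T27's `D_α⁺` 0 violations on all 6 397 kept pairs — T28-THREE-ADIC-COST-LAW.md §4] -/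
@[conjecture] def CertifiedSelmerTransferThree : Prop :=
  ∀ (W G : WeierstrassCurve ℚ) [W.IsElliptic] [W.IsGloballyMinimal] [G.IsElliptic] [G.IsGloballyMinimal],
    W.HasIrreducibleModPGaloisRep 3 → IsCongruentModThree W G → NoLocalThreeTorsionAt W 3 →
    numStableLinesAtThree W ≤ 1 → HasKummerCertificateThree W G →
      selmerDimThree W ≤ selmerDimThree G + betaBudgetThree W G ∧
        selmerDimThree G ≤ selmerDimThree W + betaBudgetThree W G

/-- **T28-β-clean `CertifiedCleanSelmerTransferThree` (THEOREM-CANDIDATE; T17 `CleanSelmerTransferThree` with the companion of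
ANY local type).**  Congruent pair, `W[3]` irreducible, CLEAN away from `3` (`H¹(ℚ_ℓ, ρ̄) = 0` at every bad `ℓ ≠ 3` of either
curve), `h⁰₃ = 0`, at most one stable line, Kummer certificate: then `Sel₃(W) = Sel₃(G)` inside `H¹(ℚ, ρ̄)` (every local
condition coincides), in particular the orders agree.  Why it might fail: only through the torsor dictionary.
[cite: MazurRubin2015SelmerCompanions, Thm. 3.1 shape] [evidence: census cell O5, o5-r1 GEN 11, P-K17 kit j139907 — T28-THREE-ADIC-COST-LAW.md §4] -/
@[conjecture] def CertifiedCleanSelmerTransferThree : Prop :=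
  ∀ (W G : WeierstrassCurve ℚ) [W.IsElliptic] [W.IsGloballyMinimal] [G.IsElliptic] [G.IsGloballyMinimal],
    W.HasIrreducibleModPGaloisRep 3 → IsCongruentModThree W G → IsCleanPairAwayFromThree W G →
    NoLocalThreeTorsionAt W 3 → numStableLinesAtThree W ≤ 1 → HasKummerCertificateThree W G →
      Nat.card (W.selmerGroup 3) = Nat.card (G.selmerGroup 3)

/-- **T28-UPPER `CertifiedTransferUpperThree` (THEOREM-CANDIDATE given T28-β; B-facing UPPER reading at grade β).**  `W` of
analytic rank `0`, `W[3]` irreducible, `h⁰₃ = 0`, a congruent companion `G` with `Sel₃(G) = 0` (rank `0`, `Ш(G)` finite,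
`3 ∤ #Ш(G)`), a Kummer certificate and `D_β ≤ 1`: then `dim Sel₃(W) ≤ 1`, EVEN (Cassels–Tate, `W(ℚ)[3] = 0`), so
`Sel₃(W) = 0` and `3 ∤ #Ш(W)` — `BSD₃(W)` on a UNIT row, the Tamagawa-free half on a TAM row.  At grade α⁺ (T27-UPPER) the
hypothesis `D ≤ 1` forces NO transverse prime at all; at grade β one transverse prime on one side is allowed.
[evidence: census cell O5, o5-r1 GEN 11, P-K17 kit j139907: arms U/T reach 0 + 64 NEW open X4 rows at grade β_cert (pathway counts, EVIDENCE) — T28-THREE-ADIC-COST-LAW.md §4] -/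
@[conjecture] def CertifiedTransferUpperThree : Prop :=
  ∀ (W G : WeierstrassCurve ℚ) [W.IsElliptic] [W.IsGloballyMinimal] [G.IsElliptic] [G.IsGloballyMinimal],
    W.HasIrreducibleModPGaloisRep 3 → IsCongruentModThree W G → NoLocalThreeTorsionAt W 3 →
    numStableLinesAtThree W ≤ 1 → HasKummerCertificateThree W G → W.analyticRank = 0 →
      G.mordellWeilRank = 0 → G.ShaFinite → ¬ 3 ∣ G.shaOrder → betaBudgetThree W G ≤ 1 → ¬ 3 ∣ W.shaOrder

/-- **T28-LOWER `CertifiedTransferLowerNineThree` (THEOREM-CANDIDATE given T28-β; B-facing LOWER reading at grade β).**  `W`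
of analytic rank `0`, `W[3]` irreducible, `h⁰₃ = 0`, a congruent companion `G` with `rank G(ℚ) ≥ D_β + 1` and a Kummer
certificate: `dim Sel₃(W) ≥ rank G − D_β ≥ 1`, even, hence `≥ 2`: `9 ∣ #Ш(W)` (with `v₃ #Ш_an = 2` and Kato at `(W,3)`,
`BSD₃(W)`).  One unit of companion rank less than T27-LOWER needs.
[evidence: census cell O5, o5-r1 GEN 11, P-K17 kit j139907: arm A reaches 32 NEW open X4 rows at grade β_cert (pathway counts, EVIDENCE) — T28-THREE-ADIC-COST-LAW.md §4] -/
@[conjecture] def CertifiedTransferLowerNineThree : Prop :=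
  ∀ (W G : WeierstrassCurve ℚ) [W.IsElliptic] [W.IsGloballyMinimal] [G.IsElliptic] [G.IsGloballyMinimal],
    W.HasIrreducibleModPGaloisRep 3 → IsCongruentModThree W G → NoLocalThreeTorsionAt W 3 →
    numStableLinesAtThree W ≤ 1 → HasKummerCertificateThree W G → W.analyticRank = 0 →
      betaBudgetThree W G + 1 ≤ G.mordellWeilRank → 9 ∣ W.shaOrder

/-! ## §4 Links (PROVED): the certificate is FREE on the class-02 twisted cells and IMPOSSIBLE across III ~ twist -/

/-- On a pair of class-02 twisted curves (`Iₙ*` / potentially-ordinary `I₀*`, `h⁰₃ = 0`) any admissible base points form a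
Kummer certificate (n2 + n3). [folklore] -/
theorem hasKummerCertificateThree_potTwist (hn2 : KummerLinePotMultThree) (hn3 : KummerLinePotOrdThree)
    (W X : WeierstrassCurve ℚ) [W.IsElliptic] [W.IsGloballyMinimal] [X.IsElliptic] [X.IsGloballyMinimal]
    (hW : Addv W 3) (hMW : SubM W 3 ∨ SubGordOrd W 3) (h1W : numStableLinesAtThree W = 1)
    (h0W : NoLocalThreeTorsionAt W 3)
    (hX : Addv X 3) (hMX : SubM X 3 ∨ SubGordOrd X 3) (h1X : numStableLinesAtThree X = 1)
    (h0X : NoLocalThreeTorsionAt X 3)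
    {x y x' y' : ℚ_[3]} (hP : IsKummerBasePointThree W x y) (hP' : IsKummerBasePointThree X x' y') :
    HasKummerCertificateThree W X :=
  ⟨x, y, x', y', hP, hP', kummerTorsorsAgree_potTwist_of hn2 hn3 W X hW hMW h1W h0W hX hMX h1X h0X x y x' y' hP hP'⟩

/-- Across type III (class 02) ~ twisted companion NO pair of admissible base points is a certificate (T18′ + n2 + n3):
the 3-adic term is necessary there. [folklore] -/
theorem not_hasKummerCertificateThree_typeIII_potTwist
    (h18 : KummerLineRamifiedQuotientThree) (hn2 : KummerLinePotMultThree) (hn3 : KummerLinePotOrdThree)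
    (W X : WeierstrassCurve ℚ) [W.IsElliptic] [W.IsGloballyMinimal] [X.IsElliptic] [X.IsGloballyMinimal]
    (h5 : ClassO5 W 3) (ht : SubTprime W 3) (h1 : numStableLinesAtThree W = 1) (hΔ : padicValRat 3 W.Δ = 3)
    (h0 : NoLocalThreeTorsionAt W 3) (hadd : Addv X 3) (hMG : SubM X 3 ∨ SubGordOrd X 3)
    (h1X : numStableLinesAtThree X = 1) (h0X : NoLocalThreeTorsionAt X 3) :
    ¬ HasKummerCertificateThree W X := by
  rintro ⟨x, y, x', y', hP, hP', hagree⟩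
  exact kummerTorsorsDifferTypeIIIPotTwistThree_of h18 hn2 hn3 W X h5 ht h1 hΔ h0 hadd hMG h1X h0X x y x' y' hP hP' hagree

end Summit.BirchSwinnertonDyer.Rank1Residual.O5
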